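import Summits.CriticalPhenomena.SAWScalingLimit.Theorems.SAWLeftRightFKGLeftRightFKGStubEndpointMonotoneAux
import Summits.CriticalPhenomena.SAWScalingLimit.Theorems.SAWLeftRightFKGLeftRightFKGStubEndpointMonotoneAux2
import HarnessLib

/-!
# Stub `stub_endpointMonotone` of line `corner-localisation`: the induction

Crux `LeftRightFKG` (stmt-CriticalPhenomena-11232); vocabulary module `…LeftRightFKGDefs`, helper
files `…StubEndpointMonotoneAux` (abstract finite sums), `…StubEndpointMonotoneAux2` (chords).

ENDPOINT MONOTONICITY FROM CORNER POSITIVITY, inside one finite chord type, by strong induction on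
the potential `Φ(Γ) = Σ_{γ ∈ Γ} ((|γ| - k) + (|γ| - m))` of `Γ = restrP k π m σ Sa Sb`,
simultaneously for (i) `BI(Γ; E, U)`, `E` next-step-determined, and (ii) `BI(Γ; F, U)`, `F`
previous-step-determined (`U` an arbitrary relative up-set). Step for (i): `E` constant on `Γ` is
trivial; else all chords of `Γ` are longer than `k`, `m` (`lt_length_of_ne`); if they share the
previous step, re-describe `Γ` with a longer suffix (`Φ` drops); else threshold the previous-step
rank of `StepMonotone` at its maximum over `Γ` (`threshold_right`) to get a previous-step up-event
`Q` splitting `Γ`, and conclude by `bi_step` (induction hypotheses on the four halves + CORNER for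
`(E, Q)`) off the diagonal, by `bi_of_rel` + `lr_of_diag` (LENS DICHOTOMY) on the diagonal
`E = Q`. Step for (ii): the mirror image. The lens dichotomy is a HYPOTHESIS of the main theorem
`cornerToEndMono_of_lensDichotomy` (registered sub-goal `stub_endpointMonotoneAux`); it is not
derivable from `StepMonotone` + `Corner` alone, see the docstring there.
-/

noncomputable section

open Finset SimpleGraph
open Literature.Probability.LatticeModels Literature.Probability.RandomPlanarGeometry
open scoped Classical

namespace Summit.CriticalPhenomena.SAWScalingLimit.Theorems.LeftRightFKG.CornerLoc

namespace EndpointMonotone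

variable {Ω : Set ℂ} {δ : ℝ} {a b : Site 2}

/-! ## Threshold events -/

/-- THRESHOLD on the previous-step rank: if the chords of a finite set `s ⊆ cls k π m σ` are
longer than `m` and show two different previous steps, thresholding the (injective, `≼`-monotone)
previous-step ranking at its maximum over `s` gives complementary previous-step-determined events
`Q` (a relative up-set) and `Q'`, both met by `s`. [folklore] -/
theorem threshold_right {k : ℕ} {π : ℕ → Site 2} {m : ℕ} {σ : ℕ → Site 2}
    (hRP : ∃ r : Site 2 → ℕ, Set.InjOn r ((zdGraph 2).neighborSet (σ m)) ∧
      ∀ γ₁ γ₂ : SAW.DomainSAW Ω δ a b, AgreeToR m σ γ₁ → AgreeToR m σ γ₂ → lr γ₁ γ₂ →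
        r (γ₁.walk.reverse.getVert (m + 1)) ≤ r (γ₂.walk.reverse.getVert (m + 1)))
    (s : Finset (SAW.DomainSAW Ω δ a b)) (hcls : ∀ γ ∈ s, γ ∈ cls k π m σ)
    (hlen : ∀ γ ∈ s, m < γ.length)
    (htwo : ∃ γ₁ ∈ s, ∃ γ₂ ∈ s,
      γ₁.walk.reverse.getVert (m + 1) ≠ γ₂.walk.reverse.getVert (m + 1)) :
    ∃ Q Q' : Set (SAW.DomainSAW Ω δ a b), PrevDet m Q ∧ PrevDet m Q' ∧
      IsUpOn (cls k π m σ) Q ∧ (∀ γ, γ ∈ Q' ↔ γ ∉ Q) ∧ (∃ γ ∈ s, γ ∈ Q) ∧ ∃ γ ∈ s, γ ∈ Q' := by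
  obtain ⟨r, hinj, hmono⟩ := hRP
  obtain ⟨γ₁, hγ₁, γ₂, hγ₂, hne⟩ := htwo
  obtain ⟨γm, hγm, hmax⟩ :=
    exists_max_image s (fun γ => r (γ.walk.reverse.getVert (m + 1))) ⟨γ₁, hγ₁⟩
  set ρ := r (γm.walk.reverse.getVert (m + 1)) with hρ
  refine ⟨{γ | ρ ≤ r (γ.walk.reverse.getVert (m + 1))},
    {γ | r (γ.walk.reverse.getVert (m + 1)) < ρ},
    fun γ γ' h => by rw [Set.mem_setOf_eq, Set.mem_setOf_eq, h],
    fun γ γ' h => by rw [Set.mem_setOf_eq, Set.mem_setOf_eq, h],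
    fun γ γ' hγ hγ' hlr hq => le_trans hq (hmono γ γ' hγ.2 hγ'.2 hlr),
    fun γ => show r (γ.walk.reverse.getVert (m + 1)) < ρ ↔ ¬ρ ≤ _ from not_le.symm,
    ⟨γm, hγm, show ρ ≤ r (γm.walk.reverse.getVert (m + 1)) from le_rfl⟩, ?_⟩
  -- the two previous steps are neighbours of `σ m`, so their ranks differ
  have hnb : ∀ γ ∈ s, γ.walk.reverse.getVert (m + 1) ∈ (zdGraph 2).neighborSet (σ m) := by
    intro γ hγ
    rw [← (hcls γ hγ).2 m le_rfl]
    exact reverse_getVert_succ_mem_neighborSet γ (hlen γ hγ)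
  have hr : r (γ₁.walk.reverse.getVert (m + 1)) ≠ r (γ₂.walk.reverse.getVert (m + 1)) :=
    fun h => hne (hinj (hnb γ₁ hγ₁) (hnb γ₂ hγ₂) h)
  rcases lt_or_gt_of_ne hr with h | h
  · exact ⟨γ₁, hγ₁, lt_of_lt_of_le h (hmax γ₂ hγ₂)⟩
  · exact ⟨γ₂, hγ₂, lt_of_lt_of_le h (hmax γ₁ hγ₁)⟩

/-- THRESHOLD on the next-step rank (mirror image of `threshold_right`). [folklore] -/
theorem threshold_left {k : ℕ} {π : ℕ → Site 2} {m : ℕ} {σ : ℕ → Site 2}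
    (hRN : ∃ r : Site 2 → ℕ, Set.InjOn r ((zdGraph 2).neighborSet (π k)) ∧
      ∀ γ₁ γ₂ : SAW.DomainSAW Ω δ a b, AgreeTo k π γ₁ → AgreeTo k π γ₂ → lr γ₁ γ₂ →
        r (γ₁.walk.getVert (k + 1)) ≤ r (γ₂.walk.getVert (k + 1)))
    (s : Finset (SAW.DomainSAW Ω δ a b)) (hcls : ∀ γ ∈ s, γ ∈ cls k π m σ)
    (hlen : ∀ γ ∈ s, k < γ.length)
    (htwo : ∃ γ₁ ∈ s, ∃ γ₂ ∈ s, γ₁.walk.getVert (k + 1) ≠ γ₂.walk.getVert (k + 1)) :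
    ∃ Q Q' : Set (SAW.DomainSAW Ω δ a b), NextDet k Q ∧ NextDet k Q' ∧
      IsUpOn (cls k π m σ) Q ∧ (∀ γ, γ ∈ Q' ↔ γ ∉ Q) ∧ (∃ γ ∈ s, γ ∈ Q) ∧ ∃ γ ∈ s, γ ∈ Q' := by
  obtain ⟨r, hinj, hmono⟩ := hRN
  obtain ⟨γ₁, hγ₁, γ₂, hγ₂, hne⟩ := htwo
  obtain ⟨γm, hγm, hmax⟩ := exists_max_image s (fun γ => r (γ.walk.getVert (k + 1))) ⟨γ₁, hγ₁⟩
  set ρ := r (γm.walk.getVert (k + 1)) with hρ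
  refine ⟨{γ | ρ ≤ r (γ.walk.getVert (k + 1))}, {γ | r (γ.walk.getVert (k + 1)) < ρ},
    fun γ γ' h => by rw [Set.mem_setOf_eq, Set.mem_setOf_eq, h],
    fun γ γ' h => by rw [Set.mem_setOf_eq, Set.mem_setOf_eq, h],
    fun γ γ' hγ hγ' hlr hq => le_trans hq (hmono γ γ' hγ.1 hγ'.1 hlr),
    fun γ => show r (γ.walk.getVert (k + 1)) < ρ ↔ ¬ρ ≤ _ from not_le.symm,
    ⟨γm, hγm, show ρ ≤ r (γm.walk.getVert (k + 1)) from le_rfl⟩, ?_⟩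
  have hnb : ∀ γ ∈ s, γ.walk.getVert (k + 1) ∈ (zdGraph 2).neighborSet (π k) := by
    intro γ hγ
    rw [← (hcls γ hγ).1 k le_rfl]
    exact getVert_succ_mem_neighborSet γ (hlen γ hγ)
  have hr : r (γ₁.walk.getVert (k + 1)) ≠ r (γ₂.walk.getVert (k + 1)) :=
    fun h => hne (hinj (hnb γ₁ hγ₁) (hnb γ₂ hγ₂) h)
  rcases lt_or_gt_of_ne hr with h | h
  · exact ⟨γ₁, hγ₁, lt_of_lt_of_le h (hmax γ₂ hγ₂)⟩
  · exact ⟨γ₂, hγ₂, lt_of_lt_of_le h (hmax γ₁ hγ₁)⟩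

/-! ## The simultaneous induction -/

/-- THE INDUCTION. For a finite chord type with fugacity `x > 0`, the lens dichotomy `hD`, the
two step rankings `hRN`, `hRP` of `StepMonotone` and corner positivity `hC` in real block form:
for every `Γ = restrP k π m σ Sa Sb` (by strong induction on its potential), the block
inequalities (i) `BI(Γ; E, U)` for next-step-determined relative up-sets `E` and (ii) `BI(Γ; F, U)`
for previous-step-determined relative up-sets `F`, against every relative up-set `U`.
[cite: EsaryProschanWalkup1967, Theorem 2.1] -/
theorem bi_of_corner [Fintype (SAW.DomainSAW Ω δ a b)] {x : ℝ} (hx : 0 < x)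
    (hD : ∀ (k : ℕ) (π : ℕ → Site 2) (m : ℕ) (σ : ℕ → Site 2) (γ₁ γ₂ : SAW.DomainSAW Ω δ a b),
      γ₁ ≠ γ₂ → γ₁ ∈ cls k π m σ → γ₂ ∈ cls k π m σ →
      (∀ i j : ℕ, k < i → i + m < γ₁.length → k < j → j + m < γ₂.length →
        γ₁.walk.getVert i ≠ γ₂.walk.getVert j) → lr γ₁ γ₂ ∨ lr γ₂ γ₁)
    (hRN : ∀ (k : ℕ) (π : ℕ → Site 2), ∃ r : Site 2 → ℕ,
      Set.InjOn r ((zdGraph 2).neighborSet (π k)) ∧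
      ∀ γ₁ γ₂ : SAW.DomainSAW Ω δ a b, AgreeTo k π γ₁ → AgreeTo k π γ₂ → lr γ₁ γ₂ →
        r (γ₁.walk.getVert (k + 1)) ≤ r (γ₂.walk.getVert (k + 1)))
    (hRP : ∀ (m : ℕ) (σ : ℕ → Site 2), ∃ r : Site 2 → ℕ,
      Set.InjOn r ((zdGraph 2).neighborSet (σ m)) ∧
      ∀ γ₁ γ₂ : SAW.DomainSAW Ω δ a b, AgreeToR m σ γ₁ → AgreeToR m σ γ₂ → lr γ₁ γ₂ →
        r (γ₁.walk.reverse.getVert (m + 1)) ≤ r (γ₂.walk.reverse.getVert (m + 1)))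
    (hC : ∀ (k : ℕ) (π : ℕ → Site 2) (m : ℕ) (σ : ℕ → Site 2) (Sa Sb : Set (Site 2))
      (A B : Set (SAW.DomainSAW Ω δ a b)) (s : Finset (SAW.DomainSAW Ω δ a b)),
      s = univ.filter (· ∈ restrP k π m σ Sa Sb) → IsUpOn (cls k π m σ) A →
      IsUpOn (cls k π m σ) B → NextDet k A → PrevDet m B →
      (∑ γ ∈ s.filter (· ∈ A), x ^ γ.length) * (∑ γ ∈ s.filter (· ∈ B), x ^ γ.length) ≤
        (∑ γ ∈ s, x ^ γ.length) * ∑ γ ∈ (s.filter (· ∈ A)).filter (· ∈ B), x ^ γ.length)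
    (n : ℕ) :
    ∀ (k : ℕ) (π : ℕ → Site 2) (m : ℕ) (σ : ℕ → Site 2) (Sa Sb : Set (Site 2))
      (s : Finset (SAW.DomainSAW Ω δ a b)), s = univ.filter (· ∈ restrP k π m σ Sa Sb) →
      ∑ γ ∈ s, ((γ.length - k) + (γ.length - m)) = n →
      (∀ E U : Set (SAW.DomainSAW Ω δ a b), IsUpOn (cls k π m σ) E → IsUpOn (cls k π m σ) U →
        NextDet k E →
        (∑ γ ∈ s.filter (· ∈ E), x ^ γ.length) * (∑ γ ∈ s.filter (· ∈ U), x ^ γ.length) ≤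
          (∑ γ ∈ s, x ^ γ.length) * ∑ γ ∈ (s.filter (· ∈ E)).filter (· ∈ U), x ^ γ.length) ∧
      (∀ F U : Set (SAW.DomainSAW Ω δ a b), IsUpOn (cls k π m σ) F → IsUpOn (cls k π m σ) U →
        PrevDet m F →
        (∑ γ ∈ s.filter (· ∈ F), x ^ γ.length) * (∑ γ ∈ s.filter (· ∈ U), x ^ γ.length) ≤
          (∑ γ ∈ s, x ^ γ.length) * ∑ γ ∈ (s.filter (· ∈ F)).filter (· ∈ U), x ^ γ.length) := by
  induction n using Nat.strong_induction_on with
  | h n ih =>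
  intro k π m σ Sa Sb s hs hΦ
  have hw : ∀ γ ∈ s, 0 < x ^ γ.length := fun γ _ => pow_pos hx _
  have hw' : ∀ γ ∈ s, 0 ≤ x ^ γ.length := fun γ _ => pow_nonneg hx.le _
  have hmem : ∀ γ, γ ∈ s ↔ γ ∈ restrP k π m σ Sa Sb := fun γ => by simp [hs]
  have hcls : ∀ γ ∈ s, γ ∈ cls k π m σ := fun γ hγ => ((hmem γ).1 hγ).1
  -- two distinct chords make every chord of `s` long
  have hlong : ∀ γ₁ ∈ s, ∀ γ₂ ∈ s, γ₁ ≠ γ₂ → ∀ γ ∈ s, k < γ.length ∧ m < γ.length := by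
    intro γ₁ h₁ γ₂ h₂ hne γ hγ
    by_cases h : γ = γ₁
    · subst h
      exact lt_length_of_ne (hcls _ hγ) (hcls _ h₂) hne
    · exact lt_length_of_ne (hcls _ hγ) (hcls _ h₁) h
  refine ⟨fun E U hE hU hNE => ?_, fun F U hF hU hPF => ?_⟩
  · ---------------------------------------------------------------- conjunct (i)
    by_cases htriv : ∀ γ₁ ∈ s, ∀ γ₂ ∈ s, (γ₁ ∈ E ↔ γ₂ ∈ E)
    · exact bi_of_const s _ E U hw' htriv
    obtain ⟨γe, hγe, hγeE, γn, hγn, hγnE⟩ : ∃ γe ∈ s, γe ∈ E ∧ ∃ γn ∈ s, γn ∉ E := by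
      by_contra hex
      refine htriv fun γ₁ hγ₁ γ₂ hγ₂ => ⟨fun h1 => ?_, fun h2 => ?_⟩
      · by_contra h2
        exact hex ⟨γ₁, hγ₁, h1, γ₂, hγ₂, h2⟩
      · by_contra h1
        exact hex ⟨γ₂, hγ₂, h2, γ₁, hγ₁, h1⟩
    have hen : γe ≠ γn := fun h => hγnE (h ▸ hγeE)
    have hlen := hlong γe hγe γn hγn hen
    by_cases hW : ∀ γ ∈ s, γ.walk.reverse.getVert (m + 1) = γe.walk.reverse.getVert (m + 1)
    · -- all chords share the previous step: re-describe with the longer suffix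
      have hset := restrP_eq_succ_right ((hmem γe).1 hγe) fun γ hγ => hW γ ((hmem γ).2 hγ)
      have hsub := cls_succ_right_subset (hcls γe hγe)
      have hs' : s = univ.filter (· ∈ restrP k π (m + 1) (fun j => γe.walk.reverse.getVert j)
          Sa Set.univ) := by rw [hs, hset]
      have hlt : ∑ γ ∈ s, ((γ.length - k) + (γ.length - (m + 1))) < n :=
        hΦ ▸ pot_lt_succ_right ⟨γe, hγe⟩ fun γ hγ => (hlen γ hγ).2
      exact (ih _ hlt k π (m + 1) _ Sa Set.univ s hs' rfl).1 E U (hE.mono hsub) (hU.mono hsub)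
        hNE
    · -- two previous steps: threshold event `Q`
      push Not at hW
      obtain ⟨γ', hγ', hY'⟩ := hW
      obtain ⟨Q, Q', hQd, hQ'd, hQup, hQQ', ⟨γq, hγq, hγqQ⟩, ⟨γq', hγq', hγq'Q⟩⟩ :=
        threshold_right (hRP m σ) s hcls (fun γ hγ => (hlen γ hγ).2) ⟨γ', hγ', γe, hγe, hY'⟩
      by_cases hdiag : ∀ γ ∈ s, (γ ∈ E ↔ γ ∈ Q)
      · -- diagonal configuration: lens dichotomy
        refine bi_of_rel s _ E U lr hw' (fun γ₁ h₁ γ₂ h₂ h₁E h₂E => ?_)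
          fun γ₁ h₁ γ₂ h₂ h₁₂ h₁U => hU γ₁ γ₂ (hcls _ h₁) (hcls _ h₂) h₁₂ h₁U
        exact lr_of_diag (hD k π m σ) hNE hQd hE (fun γ hγ => hdiag γ ((hmem γ).2 hγ)) γ₁ γ₂
          ((hmem _).1 h₁) ((hmem _).1 h₂) h₁E h₂E
      · -- generic configuration: the monotone mixture
        have hnd : ∃ γ ∈ s, ¬(γ ∈ E ↔ γ ∈ Q) := by
          by_contra h
          exact hdiag fun γ hγ => by_contra fun h' => h ⟨γ, hγ, h'⟩
        -- the complement of `E` as an opaque set (uniform decidability instances)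
        obtain ⟨E', hE'⟩ : ∃ E' : Set (SAW.DomainSAW Ω δ a b), ∀ γ, γ ∈ E' ↔ γ ∉ E :=
          ⟨Eᶜ, fun _ => Iff.rfl⟩
        have hNE' : NextDet k E' := fun γ₁ γ₂ h => by
          rw [hE', hE']; exact not_congr (hNE γ₁ γ₂ h)
        have hcolQ := by
          have e := filter_restrP_prevDet (k := k) (π := π) (σ := σ) (Sa := Sa) (Sb := Sb) hQd
          rw [← hs] at e
          refine e ▸ (ih _ ?_ k π m σ Sa _ _ rfl rfl).1 E U hE hU hNE
          rw [← hΦ, ← e]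
          exact pot_lt_of_subset (filter_subset _ _) hγq'
            (fun h => (hQQ' γq').1 hγq'Q (Finset.mem_filter.1 h).2) (hlen γq' hγq').1
        have hcolQ' := by
          have e := filter_restrP_prevDet (k := k) (π := π) (σ := σ) (Sa := Sa) (Sb := Sb) hQ'd
          rw [← hs] at e
          refine e ▸ (ih _ ?_ k π m σ Sa _ _ rfl rfl).1 E U hE hU hNE
          rw [← hΦ, ← e]
          exact pot_lt_of_subset (filter_subset _ _) hγq
            (fun h => (hQQ' γq).1 (Finset.mem_filter.1 h).2 hγqQ) (hlen γq hγq).1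
        have hrowE := by
          have e := filter_restrP_nextDet (π := π) (m := m) (σ := σ) (Sa := Sa) (Sb := Sb) hNE
          rw [← hs] at e
          refine e ▸ (ih _ ?_ k π m σ _ Sb _ rfl rfl).2 Q U hQup hU hQd
          rw [← hΦ, ← e]
          exact pot_lt_of_subset (filter_subset _ _) hγn
            (fun h => hγnE (Finset.mem_filter.1 h).2) (hlen γn hγn).1
        have hrowE' := by
          have e := filter_restrP_nextDet (π := π) (m := m) (σ := σ) (Sa := Sa) (Sb := Sb) hNE'
          rw [← hs] at e
          refine e ▸ (ih _ ?_ k π m σ _ Sb _ rfl rfl).2 Q U hQup hU hQd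
          rw [← hΦ, ← e]
          exact pot_lt_of_subset (fun γ hγ => (Finset.mem_filter.1 hγ).1) hγe
            (fun h => (hE' γe).1 (Finset.mem_filter.1 h).2 hγeE) (hlen γe hγe).1
        exact bi_step s _ E E' Q Q' U hw (fun γ _ => hE' γ) (fun γ _ => hQQ' γ) hnd
          hcolQ hcolQ' hrowE hrowE' (hC k π m σ Sa Sb E Q s hs hE hQup hNE hQd)
  · ---------------------------------------------------------------- conjunct (ii)
    by_cases htriv : ∀ γ₁ ∈ s, ∀ γ₂ ∈ s, (γ₁ ∈ F ↔ γ₂ ∈ F)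
    · exact bi_of_const s _ F U hw' htriv
    obtain ⟨γf, hγf, hγfF, γn, hγn, hγnF⟩ : ∃ γf ∈ s, γf ∈ F ∧ ∃ γn ∈ s, γn ∉ F := by
      by_contra hex
      refine htriv fun γ₁ hγ₁ γ₂ hγ₂ => ⟨fun h1 => ?_, fun h2 => ?_⟩
      · by_contra h2
        exact hex ⟨γ₁, hγ₁, h1, γ₂, hγ₂, h2⟩
      · by_contra h1
        exact hex ⟨γ₂, hγ₂, h2, γ₁, hγ₁, h1⟩
    have hfn : γf ≠ γn := fun h => hγnF (h ▸ hγfF)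
    have hlen := hlong γf hγf γn hγn hfn
    by_cases hW : ∀ γ ∈ s, γ.walk.getVert (k + 1) = γf.walk.getVert (k + 1)
    · -- all chords share the next step: re-describe with the longer prefix
      have hset := restrP_eq_succ_left ((hmem γf).1 hγf) fun γ hγ => hW γ ((hmem γ).2 hγ)
      have hsub := cls_succ_left_subset (hcls γf hγf)
      have hs' : s = univ.filter (· ∈ restrP (k + 1) (fun i => γf.walk.getVert i) m σ
          Set.univ Sb) := by rw [hs, hset]
      have hlt : ∑ γ ∈ s, ((γ.length - (k + 1)) + (γ.length - m)) < n :=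
        hΦ ▸ pot_lt_succ_left ⟨γf, hγf⟩ fun γ hγ => (hlen γ hγ).1
      exact (ih _ hlt (k + 1) _ m σ Set.univ Sb s hs' rfl).2 F U (hF.mono hsub) (hU.mono hsub)
        hPF
    · -- two next steps: threshold event `Q`
      push Not at hW
      obtain ⟨γ', hγ', hX'⟩ := hW
      obtain ⟨Q, Q', hQd, hQ'd, hQup, hQQ', ⟨γq, hγq, hγqQ⟩, ⟨γq', hγq', hγq'Q⟩⟩ :=
        threshold_left (hRN k π) s hcls (fun γ hγ => (hlen γ hγ).1) ⟨γ', hγ', γf, hγf, hX'⟩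
      by_cases hdiag : ∀ γ ∈ s, (γ ∈ F ↔ γ ∈ Q)
      · -- diagonal configuration: lens dichotomy (with `Q` in the role of `E`)
        refine bi_of_rel s _ F U lr hw' (fun γ₁ h₁ γ₂ h₂ h₁F h₂F => ?_)
          fun γ₁ h₁ γ₂ h₂ h₁₂ h₁U => hU γ₁ γ₂ (hcls _ h₁) (hcls _ h₂) h₁₂ h₁U
        exact lr_of_diag (hD k π m σ) hQd hPF hQup
          (fun γ hγ => (hdiag γ ((hmem γ).2 hγ)).symm) γ₁ γ₂ ((hmem _).1 h₁) ((hmem _).1 h₂)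
          (fun h => h₁F ((hdiag γ₁ h₁).2 h)) ((hdiag γ₂ h₂).1 h₂F)
      · -- generic configuration: the monotone mixture
        have hnd : ∃ γ ∈ s, ¬(γ ∈ F ↔ γ ∈ Q) := by
          by_contra h
          exact hdiag fun γ hγ => by_contra fun h' => h ⟨γ, hγ, h'⟩
        -- the complement of `F` as an opaque set (uniform decidability instances)
        obtain ⟨F', hF'⟩ : ∃ F' : Set (SAW.DomainSAW Ω δ a b), ∀ γ, γ ∈ F' ↔ γ ∉ F :=
          ⟨Fᶜ, fun _ => Iff.rfl⟩
        have hPF' : PrevDet m F' := fun γ₁ γ₂ h => by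
          rw [hF', hF']; exact not_congr (hPF γ₁ γ₂ h)
        have hcolQ := by
          have e := filter_restrP_nextDet (π := π) (m := m) (σ := σ) (Sa := Sa) (Sb := Sb) hQd
          rw [← hs] at e
          refine e ▸ (ih _ ?_ k π m σ _ Sb _ rfl rfl).2 F U hF hU hPF
          rw [← hΦ, ← e]
          exact pot_lt_of_subset (filter_subset _ _) hγq'
            (fun h => (hQQ' γq').1 hγq'Q (Finset.mem_filter.1 h).2) (hlen γq' hγq').1
        have hcolQ' := by
          have e := filter_restrP_nextDet (π := π) (m := m) (σ := σ) (Sa := Sa) (Sb := Sb) hQ'd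
          rw [← hs] at e
          refine e ▸ (ih _ ?_ k π m σ _ Sb _ rfl rfl).2 F U hF hU hPF
          rw [← hΦ, ← e]
          exact pot_lt_of_subset (filter_subset _ _) hγq
            (fun h => (hQQ' γq).1 (Finset.mem_filter.1 h).2 hγqQ) (hlen γq hγq).1
        have hrowF := by
          have e := filter_restrP_prevDet (k := k) (π := π) (σ := σ) (Sa := Sa) (Sb := Sb) hPF
          rw [← hs] at e
          refine e ▸ (ih _ ?_ k π m σ Sa _ _ rfl rfl).1 Q U hQup hU hQd
          rw [← hΦ, ← e]
          exact pot_lt_of_subset (filter_subset _ _) hγn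
            (fun h => hγnF (Finset.mem_filter.1 h).2) (hlen γn hγn).1
        have hrowF' := by
          have e := filter_restrP_prevDet (k := k) (π := π) (σ := σ) (Sa := Sa) (Sb := Sb) hPF'
          rw [← hs] at e
          refine e ▸ (ih _ ?_ k π m σ Sa _ _ rfl rfl).1 Q U hQup hU hQd
          rw [← hΦ, ← e]
          exact pot_lt_of_subset (fun γ hγ => (Finset.mem_filter.1 hγ).1) hγf
            (fun h => (hF' γf).1 (Finset.mem_filter.1 h).2 hγfF) (hlen γf hγf).1
        have hcorner := hC k π m σ Sa Sb Q F s hs hQup hF hQd hPF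
        rw [mul_comm, Finset.filter_comm (p := (· ∈ Q)) (q := (· ∈ F)) s] at hcorner
        exact bi_step s _ F F' Q Q' U hw (fun γ _ => hF' γ) (fun γ _ => hQQ' γ) hnd
          hcolQ hcolQ' hrowF hrowF' hcorner

/-! ## The main theorem -/

/-- ENDPOINT MONOTONICITY FROM CORNER POSITIVITY, GIVEN THE LENS DICHOTOMY. For every crux
instance: if two distinct chords of a prefix/suffix class `cls k π m σ` with vertex-disjoint free
middles are always `≼`-comparable (LENS DICHOTOMY — the reduced lens is a simple lattice polygon,
whose winding number has constant sign by the Jordan curve theorem; a topological input, taken as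
hypothesis), then `CornerToEndMono`: under `StepMonotone`, corner positivity at fugacity `x > 0`
implies endpoint monotonicity at fugacity `x`. The dichotomy cannot be dropped from this
fugacity-blind argument: in the abstract setting (three chords `γ₂; γ₁ ≼ γ₁'`, `γ₁ ≼ γ₂`, weights
arbitrary) step-rank monotonicity and all corner inequalities hold while `P(U | E) ≥ P(U | Eᶜ)`
fails for `E = {γ₂}`, `U = {γ₁'}`. [cite: EsaryProschanWalkup1967, Theorem 2.1] -/
theorem cornerToEndMono_of_lensDichotomy
    (hD : ∀ (δ : ℝ) (c a b a' b' : Site 2) (C : (zdGraph 2).Walk c c), IsInst δ a b a' b' C →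
      ∀ (k : ℕ) (π : ℕ → Site 2) (m : ℕ) (σ : ℕ → Site 2)
        (γ₁ γ₂ : SAW.DomainSAW (dom C δ) δ a b), γ₁ ≠ γ₂ → γ₁ ∈ cls k π m σ → γ₂ ∈ cls k π m σ →
        (∀ i j : ℕ, k < i → i + m < γ₁.length → k < j → j + m < γ₂.length →
          γ₁.walk.getVert i ≠ γ₂.walk.getVert j) → lr γ₁ γ₂ ∨ lr γ₂ γ₁) :
    CornerToEndMono := by
  intro hSM x hx hCorner
  have main : ∀ (δ : ℝ) (c a b a' b' : Site 2) (C : (zdGraph 2).Walk c c), IsInst δ a b a' b' C →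
      ∀ (k : ℕ) (π : ℕ → Site 2) (m : ℕ) (σ : ℕ → Site 2) (Sa Sb : Set (Site 2))
        (A B : Set (SAW.DomainSAW (dom C δ) δ a b)),
        IsUpOn (cls k π m σ) A → IsUpOn (cls k π m σ) B →
        (NextDet k A ∨ PrevDet m B) →
        μx x (dom C δ) δ a b (A ∩ restrP k π m σ Sa Sb) *
            μx x (dom C δ) δ a b (B ∩ restrP k π m σ Sa Sb) ≤
          μx x (dom C δ) δ a b (restrP k π m σ Sa Sb) *
            μx x (dom C δ) δ a b (A ∩ B ∩ restrP k π m σ Sa Sb) := by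
    intro δ c a b a' b' C hI k π m σ Sa Sb A B hA hB hdet
    obtain ⟨hfin, hRN, hRP⟩ := hSM δ c a b a' b' C hI
    haveI : Fintype (SAW.DomainSAW (dom C δ) δ a b) := Fintype.ofFinite _
    have hC' := fun k π m σ Sa Sb (A' B' : Set (SAW.DomainSAW (dom C δ) δ a b))
        (s : Finset (SAW.DomainSAW (dom C δ) δ a b))
        (hs : s = univ.filter (· ∈ restrP k π m σ Sa Sb))
        (hA' : IsUpOn (cls k π m σ) A') (hB' : IsUpOn (cls k π m σ) B') (hN : NextDet k A')
        (hP : PrevDet m B') => by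
      have h := (μx_bi_iff hx.le A' B' (restrP k π m σ Sa Sb)).1
        (hCorner δ c a b a' b' C hI k π m σ Sa Sb A' B' hA' hB' (fun _ => hN) fun _ => hP)
      rw [← hs] at h
      exact h
    have key := bi_of_corner hx (hD δ c a b a' b' C hI) hRN hRP hC' _ k π m σ Sa Sb _ rfl rfl
    rw [μx_bi_iff hx.le]
    rcases hdet with hN | hP
    · exact key.1 A B hA hB hN
    · have h := key.2 B A hB hA hP
      rw [mul_comm, Finset.filter_comm (p := (· ∈ B)) (q := (· ∈ A))] at h
      exact h
  exact ⟨fun δ c a b a' b' C hI k π m σ Sa Sb A B hA hB hN _ =>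
      main δ c a b a' b' C hI k π m σ Sa Sb A B hA hB (Or.inl (hN rfl)),
    fun δ c a b a' b' C hI k π m σ Sa Sb A B hA hB _ hP =>
      main δ c a b a' b' C hI k π m σ Sa Sb A B hA hB (Or.inr (hP rfl))⟩

end EndpointMonotone

/-- REGISTERED SUB-GOAL `stub_endpointMonotoneAux` of stub `stub_endpointMonotone` (this file's
main theorem, recorded on the crux item so that the file lands as a `--supports` proof): the
CORRECTED form of the registered signature `stub_endpointMonotone : CornerToEndMono` — endpoint
monotonicity from corner positivity GIVEN THE LENS DICHOTOMY (two distinct chords of a class with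
vertex-disjoint free middles are `≼`-comparable). [cite: EsaryProschanWalkup1967, Theorem 2.1] -/
theorem stub_endpointMonotoneAux :
    (∀ (δ : ℝ) (c a b a' b' : Site 2) (C : (zdGraph 2).Walk c c), IsInst δ a b a' b' C →
      ∀ (k : ℕ) (π : ℕ → Site 2) (m : ℕ) (σ : ℕ → Site 2)
        (γ₁ γ₂ : SAW.DomainSAW (dom C δ) δ a b), γ₁ ≠ γ₂ → γ₁ ∈ cls k π m σ → γ₂ ∈ cls k π m σ →
        (∀ i j : ℕ, k < i → i + m < γ₁.length → k < j → j + m < γ₂.length →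
          γ₁.walk.getVert i ≠ γ₂.walk.getVert j) → lr γ₁ γ₂ ∨ lr γ₂ γ₁) →
    CornerToEndMono :=
  EndpointMonotone.cornerToEndMono_of_lensDichotomy

end Summit.CriticalPhenomena.SAWScalingLimit.Theorems.LeftRightFKG.CornerLoc

end
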